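import Summits.NavierStokesRegularity.FluidComputer.PalasekTowerRegisterGlobalFloorsAtSlice

/-!
# REGISTER v2.3′: slice certificates — ONE tame free run from a slice decides the slice's free-run obligation

Cell `ns-blowup`, seat `ns-palasek-19249-p2` (prover; D-0081 §C stub-worker on item stmt-NavierStokesRegularity-19249
`HeredityAtOne`, registered stubs `SpeedFloorAt 1` / `StrainFloorAt 1` / `CoreFloorAt 1`). Companion of
`PalasekTowerRegisterGlobalFloorsAtSlice.lean` (this seat, p459039: `SliceRun S k P v`, `readoutAt_iff_sliceRun`) and of
`PalasekTowerHeredityWitnessUnconditional.lean` (ecbridge-6 g2: the W14-free uniqueness `velocity_eq_of_bounded_classical`,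
forced Serrin–Masuda). LABEL: E–C typing (KERNEL plumbing; every statement proved, no definition, no named fact). WHAT
THIS IS NOT: not Navier–Stokes evidence — no run, slice, stage or tower is constructed; the stubs stay OPEN.

* `SliceRun.of_exists` — if ONE classical solution of the unforced system on the window slab from the slice `v`, of
  finite energy and inside the next ceiling, ends with `P`, then EVERY such run does (`SliceRun S k P v`): two tame
  runs from the same slice share their velocity (the certified run is the bounded competitor; zero force is Clay
  class). So a slice's free-run obligation is settled by ONE CERTIFICATE — the interface against which a designed or
  numerically found level-1 profile is to be certified.
* `readoutAt_of_sliceCertificates` (`k ≥ 1`) — one certificate per registered level-`k` slice gives `ReadoutAt k P`;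
  instances `speedFloorAt_one_of_sliceCertificates`, `readoutFloorsAt_one_of_sliceCertificates` (item 19249's lower
  stubs from one tame free run per registered level-1 slice ending with speed `≥ Y₂` / with the level-2 letter).

References: H. Sohr, *The Navier–Stokes Equations*, Birkhäuser 2001, Ch. V Thm. 1.5.1 [cite: Sohr2001, Ch. V Thm. 1.5.1];
S. Palasek, arXiv:2605.13827 §4 [cite: Palasek2026ElementaryModel, §4]; C. L. Fefferman, Clay problem description, (5)–(6)
with `f ≡ 0` [cite: FeffermanClay2006, (5) (6)].
-/

noncomputable section

namespace Summit.NavierStokesRegularity.FluidComputer.PalasekTowerClayBridge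

open Set MeasureTheory Filter Topology Function Real
open scoped ENNReal ContDiff NNReal
open Literature.Analysis.FluidPDE
open Summit.NavierStokesRegularity.NavierStokesRegularity

/-- The zero force is smooth on the closed half-space (Fefferman (6) for `f ≡ 0`). [cite: FeffermanClay2006, (5) (6)] -/
private theorem isSmoothOnHalfSpace_zero_force :
    IsSmoothOnHalfSpace (0 : ℝ → EuclideanSpace ℝ (Fin 3) → EuclideanSpace ℝ (Fin 3)) := by
  have h : uncurry (0 : ℝ → EuclideanSpace ℝ (Fin 3) → EuclideanSpace ℝ (Fin 3)) = fun _ => 0 := by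
    funext q; rfl
  rw [IsSmoothOnHalfSpace, h]
  exact contDiffOn_const

/-- The zero force has Fefferman's space-time decay (5): all its derivatives vanish. [cite: FeffermanClay2006, (5) (6)] -/
private theorem hasRapidSpaceTimeDecay_zero_force :
    HasRapidSpaceTimeDecay (0 : ℝ → EuclideanSpace ℝ (Fin 3) → EuclideanSpace ℝ (Fin 3)) := by
  intro n K
  have h : uncurry (0 : ℝ → EuclideanSpace ℝ (Fin 3) → EuclideanSpace ℝ (Fin 3)) = 0 := by
    funext q; rfl
  refine ⟨0, fun t _ x => ?_⟩
  rw [h, iteratedFDerivWithin_zero]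
  simp

/-- **ONE CERTIFICATE SETTLES A SLICE.** If some classical solution `(w, r)` of the UNFORCED system (unit viscosity)
on the window slab `[0, τ (k+1) − τ k]` with `w 0 = v`, of finite energy and inside the next ceiling `c₂ Y_{k+1}`, ends
with `P S (w (τ (k+1) − τ k))`, then `SliceRun S k P v`: any other such run `w'` has `w' = w` on the slab
(`velocity_eq_of_bounded_classical` with the zero force, `w` the bounded competitor). [cite: Sohr2001, Ch. V Thm. 1.5.1] -/
theorem SliceRun.of_exists {S : Schedule TowerRates.wide} {k : ℕ}
    {P : Schedule TowerRates.wide → (EuclideanSpace ℝ (Fin 3) → EuclideanSpace ℝ (Fin 3)) → Prop}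
    {v : EuclideanSpace ℝ (Fin 3) → EuclideanSpace ℝ (Fin 3)}
    (h : ∃ (w : ℝ → EuclideanSpace ℝ (Fin 3) → EuclideanSpace ℝ (Fin 3)) (r : ℝ → EuclideanSpace ℝ (Fin 3) → ℝ),
      IsClassicalNSSolutionOn (Icc 0 (S.τ (k + 1) - S.τ k)) 1 0 w r ∧ w 0 = v ∧
      (∃ C : ℝ≥0∞, C < ⊤ ∧ ∀ σ ∈ Icc 0 (S.τ (k + 1) - S.τ k), ∫⁻ x, ‖w σ x‖ₑ ^ 2 ≤ C) ∧
      (∀ σ ∈ Icc 0 (S.τ (k + 1) - S.τ k), ∀ x, ‖w σ x‖ ≤ S.c₂ * TowerRates.wide.Y (k + 1)) ∧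
      P S (w (S.τ (k + 1) - S.τ k))) :
    SliceRun S k P v := by
  obtain ⟨w, r, hw, hw0, hE, hB, hP⟩ := h
  intro w' r' hw' hw0' hE' _
  have hW : 0 < S.τ (k + 1) - S.τ k := by linarith [S.τ_lt_succ k]
  have heq : ∀ σ ∈ Icc 0 (S.τ (k + 1) - S.τ k), w' σ = w σ :=
    velocity_eq_of_bounded_classical one_pos hW isSmoothOnHalfSpace_zero_force hasRapidSpaceTimeDecay_zero_force
      hw hE hB hw' hE' (hw0'.trans hw0.symm)
  rw [heq _ ⟨hW.le, le_rfl⟩]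
  exact hP

/-- **ONE CERTIFICATE PER REGISTERED SLICE GIVES THE READOUT SCHEMA** (`k ≥ 1`): if for every pinned rigid quiet
wide schedule and every registered level-`k` stage `s` some tame unforced run from the slice `s.u (τ k)` ends with
`P`, then `ReadoutAt k P` (`SliceRun.of_exists` and `readoutAt_iff_sliceRun`). [cite: Palasek2026ElementaryModel, §4] -/
theorem readoutAt_of_sliceCertificates {k : ℕ} (hk : 1 ≤ k)
    {P : Schedule TowerRates.wide → (EuclideanSpace ℝ (Fin 3) → EuclideanSpace ℝ (Fin 3)) → Prop}
    (h : ∀ S : Schedule TowerRates.wide, S.Pins 8 (6 / 5) → S.Rigid → S.Quiet →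
      ∀ s : Stage 1 TowerRates.wide S (Margins.routeG TowerRates.wide) k,
        ∃ (w : ℝ → EuclideanSpace ℝ (Fin 3) → EuclideanSpace ℝ (Fin 3)) (r : ℝ → EuclideanSpace ℝ (Fin 3) → ℝ),
          IsClassicalNSSolutionOn (Icc 0 (S.τ (k + 1) - S.τ k)) 1 0 w r ∧ w 0 = s.u (S.τ k) ∧
          (∃ C : ℝ≥0∞, C < ⊤ ∧ ∀ σ ∈ Icc 0 (S.τ (k + 1) - S.τ k), ∫⁻ x, ‖w σ x‖ₑ ^ 2 ≤ C) ∧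
          (∀ σ ∈ Icc 0 (S.τ (k + 1) - S.τ k), ∀ x, ‖w σ x‖ ≤ S.c₂ * TowerRates.wide.Y (k + 1)) ∧
          P S (w (S.τ (k + 1) - S.τ k))) :
    ReadoutAt k P :=
  (readoutAt_iff_sliceRun hk).2 fun S hP hR hQ s => SliceRun.of_exists (h S hP hR hQ s)

/-- **The speed stub of item 19249 from slice certificates**: one unforced finite-energy classical run of length
`τ₂ − τ₁` per registered level-1 slice, staying `≤ (5/3)·Y₂` and ending with speed `≥ Y₂` somewhere in the ball,
proves `SpeedFloorAt 1`. [cite: Palasek2026ElementaryModel, §4] -/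
theorem speedFloorAt_one_of_sliceCertificates
    (h : ∀ S : Schedule TowerRates.wide, S.Pins 8 (6 / 5) → S.Rigid → S.Quiet →
      ∀ s : Stage 1 TowerRates.wide S (Margins.routeG TowerRates.wide) 1,
        ∃ (w : ℝ → EuclideanSpace ℝ (Fin 3) → EuclideanSpace ℝ (Fin 3)) (r : ℝ → EuclideanSpace ℝ (Fin 3) → ℝ),
          IsClassicalNSSolutionOn (Icc 0 (S.τ 2 - S.τ 1)) 1 0 w r ∧ w 0 = s.u (S.τ 1) ∧
          (∃ C : ℝ≥0∞, C < ⊤ ∧ ∀ σ ∈ Icc 0 (S.τ 2 - S.τ 1), ∫⁻ x, ‖w σ x‖ₑ ^ 2 ≤ C) ∧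
          (∀ σ ∈ Icc 0 (S.τ 2 - S.τ 1), ∀ x, ‖w σ x‖ ≤ S.c₂ * TowerRates.wide.Y 2) ∧
          ∃ x, ‖x‖ ≤ S.radius ∧ S.c₁ * TowerRates.wide.Y 2 ≤ ‖w (S.τ 2 - S.τ 1) x‖) :
    SpeedFloorAt 1 :=
  readoutAt_of_sliceCertificates le_rfl h

/-- **The whole lower stub of item 19249 from slice certificates**: one tame unforced run per registered level-1
slice ending with the level-2 LETTER in the ball proves `ReadoutFloorsAt 1` (hence the three registered floor stubs).
[cite: Palasek2026ElementaryModel, §4] -/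
theorem readoutFloorsAt_one_of_sliceCertificates
    (h : ∀ S : Schedule TowerRates.wide, S.Pins 8 (6 / 5) → S.Rigid → S.Quiet →
      ∀ s : Stage 1 TowerRates.wide S (Margins.routeG TowerRates.wide) 1,
        ∃ (w : ℝ → EuclideanSpace ℝ (Fin 3) → EuclideanSpace ℝ (Fin 3)) (r : ℝ → EuclideanSpace ℝ (Fin 3) → ℝ),
          IsClassicalNSSolutionOn (Icc 0 (S.τ 2 - S.τ 1)) 1 0 w r ∧ w 0 = s.u (S.τ 1) ∧
          (∃ C : ℝ≥0∞, C < ⊤ ∧ ∀ σ ∈ Icc 0 (S.τ 2 - S.τ 1), ∫⁻ x, ‖w σ x‖ₑ ^ 2 ≤ C) ∧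
          (∀ σ ∈ Icc 0 (S.τ 2 - S.τ 1), ∀ x, ‖w σ x‖ ≤ S.c₂ * TowerRates.wide.Y 2) ∧
          Letter S 2 (w (S.τ 2 - S.τ 1))) :
    ReadoutFloorsAt 1 :=
  readoutFloorsAt_iff_readoutAt_letter.2 (readoutAt_of_sliceCertificates le_rfl h)

end Summit.NavierStokesRegularity.FluidComputer.PalasekTowerClayBridge

end
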